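import Summits.ResolutionOfSingularities.ResolutionOfSingularities.Theorems.ConeCutLawE
import HarnessLib

/-!
# ConeCutZigzag — tree file 8/11: §B⁺⁺ ZIGZAG RIGIDITY — LAW C: the Fibonacci bookkeeping and
`zigzag_rigid` (an eventually-pure
zigzag of proximity repeats is ledger-rigid), `lt_two_mul_shade_of_zigzag`.  PROVED.

Content VERBATIM from the decomp-res lens-3 g15 file `HOME/decomp-res-lens-3/g15/parts/ConeCut-rev5-f76e5309.lean`
(sha256 f76e53096babc227…; CRITIC-LEDGER
rows 102/105/110/123 CLEARED, landing orders 15:53:15Z / 17:40:15Z).  HOME = run/shared/lean/pub/decomp-res.  Host: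
route `MaxContactCut`, aside
31770 `DefectWalksDeep` (and 31870) through the tree's lens-3 g14 `Theorems/FloorCut{Classes,Floor}` + `MaxContactCutFloorCut`.

[WRITER NOTE (decomp-res writer g6): per the lens's own landing instruction its §0 (l.130–876 = g14 `FloorCut`
VERBATIM) is DELETED and the
tree's `…Theorems.FloorCut` opened instead; §C⁵ `section AxisLaw` (l.2949–3086) is the tree's
`Theorems/ConeCutAxisLaw` (landed earlier,
opened here); the restated ProximityCut letters `LeavesNewest` / `StaysOnNewest` / `leavesNewest_iff_not_stays` /
`NoFreePointTailsDeep`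
(byte-identical to `Theorems/ProximityCutClasses`) are deleted and opened from the tree; the three class definitions
`IsTameFrom`,
`NoMixedTailsDeep`, `NoTameMixedTailsDeep` live in the cone-free `Theorems/ConeCutClasses` (so the route can import
the co-owned MIXED
aside).  Split: ConeCutClasses · ConeCutLayers / ConeCutLayersPoint (§A state level) · ConeCutWalks (§B) ·
ConeCutLawB (§C) · ConeCutRepeats
(§B⁺, §B⁺⁺⁺ part 1) · ConeCutLawE (§B⁺⁺⁺ part 2, LAW E) · ConeCutZigzag (§B⁺⁺
Fibonacci/zigzag, LAW C) · ConeCutLaws (all-repeat rigidity,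
LAW I, §D booking) · MaxContactCutConeCut / MaxContactCutConeCutCells (§D wiring to 31770/31870 BY NAME, Theses
cone).  ONE namespace
`…Theorems.ConeCut` as in the lens; global `set_option` lines dropped; nothing else changed.]
(Sources: Hauser2010 §§D,F,G; HauserPerlega2019; Moh1987; CossartPiltant2019; CossartJannsenSaito2020 Thm. 2.14,
§§5,9; BenitoVillamayor2013 §7; CasasAlvero2000 Ch. 3; BierstoneGrigorievMilmanWlodarczyk2011 Def. 3.1.3.)
-/

noncomputable section

open MvPolynomial Finset
open Literature.AlgebraicGeometry.Resolution
open Literature.AlgebraicGeometry.Resolution.Hauser2010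
open Literature.AlgebraicGeometry.Resolution.PointBlowup
open Summit.ResolutionOfSingularities.ResolutionOfSingularities.Theorems.TightDefectClasses
open Summit.ResolutionOfSingularities.ResolutionOfSingularities.Theorems.TightDefectStrongWalks
open Summit.ResolutionOfSingularities.ResolutionOfSingularities.Theorems.ItineraryCutClasses
open Summit.ResolutionOfSingularities.ResolutionOfSingularities.Theorems.BoundaryLedger
open Literature.AlgebraicGeometry.Resolution.WeightedBlowup
open Literature.Barriers.ResolutionOfSingularities
open Summit.ResolutionOfSingularities.ResolutionOfSingularities.Theorems.FloorCut
open Summit.ResolutionOfSingularities.ResolutionOfSingularities.Theorems.ConeCutAxisLaw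
open Summit.ResolutionOfSingularities.ResolutionOfSingularities.Theorems.ProximityCut (NoOriginTails LeavesNewest StaysOnNewest)
open Summit.ResolutionOfSingularities.ResolutionOfSingularities.Theorems.ProximityCut (leavesNewest_iff_not_stays NoFreePointTailsDeep)
open Summit.ResolutionOfSingularities.ResolutionOfSingularities.Theorems.ExitLaw (fin3_cases)

namespace Summit.ResolutionOfSingularities.ResolutionOfSingularities.Theorems.ConeCut

/-! ## §B⁺⁺ ZIGZAG RIGIDITY (g15 rev 2): LAW C — an eventually-pure zigzag of proximity repeats is ledger-rigid

After the double-repeat law, consecutive repeats either ZIGZAG (`j_{t+2} = j_t`: charts alternate `a, c, a, c, …`, every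
centre on `E_a ∩ E_c`, translated along the third axis `k`) or switch charts with a translation.  LAW C decides the SHAPE
of an eventually-pure zigzag on a high plateau with translations i.o.: the first late translation kills `E_k` for good,
after which the plateau ledger reads `x_{v+2} + (q − s) = x_{v+1} + x_v` (`x = o − q ∈ [1, q−1]`) — a bounded integer
FIBONACCI recurrence around `q − s`, hence constant: `o_v = 2q − s`, `r = (q − s)(e_a + e_c)`; child isolation
(`pair_lt_of_isolatedTop`) then forces `2(q − s) < q`, i.e. **`q < 2s`**: zigzag tails of shade `s ≤ q/2` do not exist. -/

section Fibonacci

/-- Growth: an integer Fibonacci-recurrent sequence with a pair `(≥ 0, ≥ 1)` exceeds every bound. [folklore] -/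
theorem fib_escape (y : ℕ → ℤ) {u₀ : ℕ} (hrec : ∀ u, u₀ ≤ u → y (u + 2) = y (u + 1) + y u) {B : ℤ}
    (hB : ∀ u, u₀ ≤ u → y u ≤ B) {u : ℕ} (hu : u₀ ≤ u) (h0 : 0 ≤ y u) (h1 : 1 ≤ y (u + 1)) : False := by
  have hP : ∀ k, 0 ≤ y (u + k) ∧ 1 ≤ y (u + k + 1) := by
    intro k
    induction k with
    | zero => exact ⟨by simpa using h0, by simpa using h1⟩
    | succ k ih =>
      refine ⟨?_, ?_⟩
      · have e : u + (k + 1) = u + k + 1 := by omega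
        rw [e]; linarith [ih.2]
      · have e : u + (k + 1) + 1 = u + k + 2 := by omega
        rw [e, hrec (u + k) (by omega)]; linarith [ih.1, ih.2]
  have hT : ∀ m : ℕ, (m : ℤ) + 1 ≤ y (u + 2 * m + 1) := by
    intro m
    induction m with
    | zero => simpa using h1
    | succ m ih =>
      have e : u + 2 * (m + 1) + 1 = u + 2 * m + 1 + 2 := by omega
      have e' : u + 2 * m + 1 + 1 = u + (2 * m + 1) + 1 := by omega
      rw [e, hrec (u + 2 * m + 1) (by omega), e']
      have h2 := (hP (2 * m + 1)).2
      push_cast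
      linarith
  have hB0 : 0 ≤ B := h0.trans (hB u hu)
  have h := hT B.toNat
  have h' := hB (u + 2 * B.toNat + 1) (by omega)
  have : (B.toNat : ℤ) = B := Int.toNat_of_nonneg hB0
  linarith

/-- The inductive step of the boundedness lemma, positive case. [folklore] -/
theorem fib_step (y : ℕ → ℤ) {u₀ : ℕ} (hrec : ∀ u, u₀ ≤ u → y (u + 2) = y (u + 1) + y u) {B : ℤ}
    (hB : ∀ u, u₀ ≤ u → |y u| ≤ B) {n : ℕ}
    (IH : ∀ u, u₀ ≤ u → |y u| + |y (u + 1)| ≤ (n : ℤ) → y u = 0)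
    {u : ℕ} (hu : u₀ ≤ u) (hmeas : |y u| + |y (u + 1)| ≤ (n : ℤ) + 1) (ha : 1 ≤ y u) : False := by
  have hB' : ∀ u, u₀ ≤ u → y u ≤ B := fun u hu => (le_abs_self _).trans (hB u hu)
  have hBn : ∀ u, u₀ ≤ u → (fun v => -y v) u ≤ B := fun u hu => (neg_le_abs _).trans (hB u hu)
  have hrecn : ∀ u, u₀ ≤ u → (fun v => -y v) (u + 2) = (fun v => -y v) (u + 1) + (fun v => -y v) u := by
    intro u hu; show -y (u + 2) = -y (u + 1) + -y u; rw [hrec u hu]; ring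
  rcases le_or_gt 0 (y (u + 1)) with hb | hb
  · -- pair `(≥ 1, ≥ 0)`: escape from `u + 1`
    have h2 : 1 ≤ y (u + 1 + 1) := by
      rw [show u + 1 + 1 = u + 2 by omega, hrec u hu]; linarith
    exact fib_escape y hrec hB' (by omega : u₀ ≤ u + 1) hb h2
  · -- `b ≤ -1`
    rcases le_or_gt (y u + y (u + 1)) 0 with hab | hab
    · -- pair `(b, a+b) = (≤ -1, ≤ 0)`: escape for `-y` from `u + 2`
      have h2 : 0 ≤ -y (u + 2) := by rw [hrec u hu]; linarith
      have h3 : 1 ≤ -y (u + 2 + 1) := by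
        rw [show u + 2 + 1 = (u + 1) + 2 by omega, hrec (u + 1) (by omega), show u + 1 + 1 = u + 2 by omega,
          hrec u hu]
        linarith
      exact fib_escape (fun v => -y v) hrecn hBn (by omega : u₀ ≤ u + 2) h2 h3
    · -- straddle: the measure drops at `u + 1`
      have hm : |y (u + 1)| + |y (u + 1 + 1)| ≤ (n : ℤ) := by
        rw [show u + 1 + 1 = u + 2 by omega, hrec u hu, abs_of_neg hb, add_comm (y (u + 1)) (y u), abs_of_pos hab]
        rw [abs_of_pos (by linarith : 0 < y u), abs_of_neg hb] at hmeas
        linarith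
      have h0 := IH (u + 1) (by omega) hm
      linarith

/-- **Bounded integer Fibonacci-recurrent sequences vanish.** [folklore] -/
theorem fib_bounded_zero (y : ℕ → ℤ) {u₀ : ℕ} (hrec : ∀ u, u₀ ≤ u → y (u + 2) = y (u + 1) + y u) {B : ℤ}
    (hB : ∀ u, u₀ ≤ u → |y u| ≤ B) : ∀ u, u₀ ≤ u → y u = 0 := by
  have hrecn : ∀ u, u₀ ≤ u → (fun v => -y v) (u + 2) = (fun v => -y v) (u + 1) + (fun v => -y v) u := by
    intro u hu; show -y (u + 2) = -y (u + 1) + -y u; rw [hrec u hu]; ring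
  have hBn : ∀ u, u₀ ≤ u → |(fun v => -y v) u| ≤ B := fun u hu => by simp only [abs_neg]; exact hB u hu
  suffices h : ∀ n : ℕ, ∀ u, u₀ ≤ u → |y u| + |y (u + 1)| ≤ (n : ℤ) → y u = 0 by
    intro u hu
    have hB0 : 0 ≤ B := (abs_nonneg _).trans (hB u hu)
    refine h (2 * B.toNat) u hu ?_
    have : (B.toNat : ℤ) = B := Int.toNat_of_nonneg hB0
    have h1 := hB u hu; have h2 := hB (u + 1) (by omega)
    push_cast; linarith
  intro n
  induction n with
  | zero =>
    intro u hu hm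
    have h1 := abs_nonneg (y u); have h2 := abs_nonneg (y (u + 1))
    have : |y u| = 0 := by push_cast at hm; linarith
    exact abs_eq_zero.mp this
  | succ n IH =>
    intro u hu hm
    push_cast at hm
    rcases lt_trichotomy (y u) 0 with ha | ha | ha
    · -- negative: run the positive step for `-y`
      have IHn : ∀ u, u₀ ≤ u → |(fun v => -y v) u| + |(fun v => -y v) (u + 1)| ≤ (n : ℤ) → (fun v => -y v) u = 0 := by
        intro u hu hm'
        simp only [abs_neg] at hm'
        simp only [IH u hu hm', neg_zero]
      have hm' : |(fun v => -y v) u| + |(fun v => -y v) (u + 1)| ≤ (n : ℤ) + 1 := by simpa only [abs_neg] using hm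
      exact (fib_step (fun v => -y v) hrecn hBn IHn hu hm' (by show 1 ≤ -y u; linarith)).elim
    · exact ha
    · exact (fib_step y hrec hB IH hu hm (by linarith)).elim

end Fibonacci

section Zigzag

variable {K : Type} [Field K] [DecidableEq K] {q : ℕ} {s₀ : State (Fin 3) K}

/-- A pure zigzag from `M`: every move is a proximity repeat and the charts alternate. DEFINITION (support). -/
def IsZigzagFrom (W : ForcedWalk q s₀) (M : ℕ) : Prop := ∀ t, M ≤ t → StaysOnNewest W t ∧ W.j (t + 2) = W.j t

/-- On a zigzag only the two charts `j_M, j_{M+1}` occur. [folklore] -/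
theorem zigzag_chart_mem (W : ForcedWalk q s₀) {M : ℕ} (hz : IsZigzagFrom W M) :
    ∀ u, M ≤ u → W.j u = W.j M ∨ W.j u = W.j (M + 1) := by
  suffices h : ∀ d, W.j (M + d) = W.j M ∨ W.j (M + d) = W.j (M + 1) by
    intro u hu; obtain ⟨d, rfl⟩ := Nat.exists_eq_add_of_le hu; exact h d
  intro d
  induction d using Nat.strong_induction_on with
  | _ d ih =>
    match d with
    | 0 => exact Or.inl rfl
    | 1 => exact Or.inr rfl
    | d + 2 =>
      have h := (hz (M + d) (by omega)).2
      rw [show M + (d + 2) = M + d + 2 by omega, h]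
      exact ih d (by omega)

/-- After a translated zigzag move `t + 1` (`b_{t+1} k ≠ 0` for the third index `k`) the third component is gone for
good: `r_u(k) = 0` for `u ≥ t + 2`. [new] [folklore] -/
theorem zigzag_r_third_eq_zero (hroot : IsRoot q s₀) (W : ForcedWalk q s₀) {M : ℕ}
    {k : Fin 3} (hk : ∀ u, M ≤ u → k ≠ W.j u) {t : ℕ} (ht : M ≤ t) (hb : W.b (t + 1) k ≠ 0) :
    ∀ u, t + 2 ≤ u → (W.st u).r k = 0 := by
  classical
  intro u hu
  induction u, hu using Nat.le_induction with
  | base =>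
    obtain ⟨o, ho, -⟩ := walk_nat hroot W (t + 1)
    rw [show t + 2 = t + 1 + 1 by omega, r_succ_eq W (t + 1) ho, Finsupp.add_apply, kept_apply,
      if_neg (fun h => hb h.2), Finsupp.single_eq_of_ne (hk (t + 1) (by omega)), add_zero]
  | succ u hu ih =>
    obtain ⟨o, ho, -⟩ := walk_nat hroot W u
    rw [r_succ_eq W u ho, Finsupp.add_apply, kept_apply, Finsupp.single_eq_of_ne (hk u (by omega)), add_zero]
    split_ifs
    · exact ih
    · rfl

/-- The kept vector of a late zigzag move `v + 1`: only the previous exceptional component `E_{j_v}`, with its mass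
`o_v − q`. [new] [folklore] -/
theorem zigzag_kept_succ (hroot : IsRoot q s₀) (W : ForcedWalk q s₀) {M : ℕ} (hz : IsZigzagFrom W M)
    {k : Fin 3} (hk : ∀ u, M ≤ u → k ≠ W.j u) {t : ℕ} (ht : M ≤ t) (hb : W.b (t + 1) k ≠ 0)
    {v : ℕ} (hv : t + 1 ≤ v) {o : ℕ} (ho : ordZero (W.st v).F = o) :
    kept W (v + 1) = Finsupp.single (W.j v) (o - q) := by
  classical
  have hS : StaysOnNewest W v := (hz v (by omega)).1
  have hkv := zigzag_r_third_eq_zero hroot W hk ht hb (v + 1) (by omega)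
  ext l
  rw [kept_apply, Finsupp.single_apply]
  rcases fin3_cases hS.1.symm (hk v (by omega)) (hk (v + 1) (by omega)) l with hl | hl | hl
  · -- `l = j_v`: kept, mass `o_v − q`
    rw [hl, if_pos ⟨hS.1.symm, hS.2⟩, if_pos rfl, NoJump.r_succ_chart W v ho]
  · -- `l = j_{v+1}`: the chart
    rw [hl, if_neg (fun h => h.1 rfl), if_neg (fun h => hS.1 h.symm)]
  · -- `l = k`: gone
    rw [hl, if_neg (show ¬ (W.j v = k) from fun h => hk v (by omega) h.symm)]
    split_ifs
    · exact hkv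
    · rfl

/-- **LAW C — ZIGZAG RIGIDITY (PROVED)**: on a high plateau of shade `s < q` (from `N`), an eventually-pure ZIGZAG of
proximity repeats (`IsZigzagFrom W M`, `N ≤ M`) with translations i.o. is ledger-rigid: from some `M'` on the order is
the constant `2q − s` and the boundary is `(q − s)(e_{j_v} + e_{j_{v+1}})` — both hugged components carry mass `q − s`.
(First late translation kills the third component; then the plateau ledger is a bounded integer Fibonacci recurrence
around `q − s`, `fib_bounded_zero`.)  The symmetric twin of LAW B. [new] [folklore] -/
theorem zigzag_rigid (hroot : IsRoot q s₀) (W : ForcedWalk q s₀) {N s M : ℕ} (hsq : s < q)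
    (hplat : ∀ t, N ≤ t → (W.st t).shade = (s : ℕ∞) ∧ ((q : ℕ) : ℕ∞) < ordZero (W.st t).F)
    (htr : ∀ M₀ : ℕ, ∃ i, M₀ ≤ i ∧ W.b i ≠ 0) (hNM : N ≤ M) (hz : IsZigzagFrom W M) :
    ∃ M', M ≤ M' ∧ ∀ v, M' ≤ v → ordZero (W.st v).F = ((2 * q - s : ℕ) : ℕ∞) ∧
      (W.st (v + 1)).r = Finsupp.single (W.j v) (q - s) + Finsupp.single (W.j (v + 1)) (q - s) := by
  classical
  -- the third index
  have hac : W.j M ≠ W.j (M + 1) := fun h => (hz M le_rfl).1.1 h.symm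
  obtain ⟨k, hka, hkc⟩ : ∃ k : Fin 3, k ≠ W.j M ∧ k ≠ W.j (M + 1) := by
    have aux : ∀ a c : Fin 3, ∃ k : Fin 3, k ≠ a ∧ k ≠ c := by decide
    exact aux _ _
  have hk : ∀ u, M ≤ u → k ≠ W.j u := by
    intro u hu h
    rcases zigzag_chart_mem W hz u hu with h' | h'
    · exact hka (h.trans h')
    · exact hkc (h.trans h')
  -- a late translation is along the third axis
  obtain ⟨i, hi, hbi⟩ := htr (M + 1)
  obtain ⟨t, rfl⟩ : ∃ t, i = t + 1 := ⟨i - 1, by omega⟩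
  have ht : M ≤ t := by omega
  have hb : W.b (t + 1) k ≠ 0 := by
    intro hbk
    apply hbi
    funext l
    rcases fin3_cases (hz t ht).1.1.symm (hk t ht) (hk (t + 1) (by omega)) l with hl | hl | hl
    · rw [hl]; exact (hz t ht).1.2
    · rw [hl]; exact W.onExc (t + 1)
    · rw [hl]; exact hbk
  -- nat orders
  set O : ℕ → ℕ := fun v => Classical.choose (walk_nat hroot W v) with hOdef
  have hO : ∀ v, ordZero (W.st v).F = ((O v : ℕ) : ℕ∞) := fun v => (Classical.choose_spec (walk_nat hroot W v)).1
  have hlo : ∀ v, N ≤ v → q < O v := by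
    intro v hv; have h := (hplat v hv).2; rw [hO v] at h; exact_mod_cast h
  have hhi : ∀ v, O v < 2 * q := by
    intro v
    obtain ⟨o, ho, -, h2⟩ := NoJump.order_lt_two_mul hroot W v
    have : O v = o := by have h := (hO v).symm.trans ho; exact_mod_cast h
    omega
  -- the ledger recurrence for `v ≥ t + 1`
  have hrec : ∀ v, t + 1 ≤ v → O (v + 2) + q + q = O (v + 1) + s + O v := by
    intro v hv
    have hks := zigzag_kept_succ hroot W hz hk ht hb hv (hO v)
    have hstep := order_succ_of_plateau hroot W (v + 1) (hO (v + 1)) (hO (v + 2)) (hplat (v + 1) (by omega)).1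
      (by rw [(hplat (v + 1 + 1) (by omega)).1, (hplat (v + 1) (by omega)).1])
    rw [hks, Finsupp.degree_single] at hstep
    have := hlo v (by omega)
    omega
  -- Fibonacci around `q − s`
  have hy := fib_bounded_zero (fun v => (O v : ℤ) + s - 2 * q) (u₀ := t + 1)
    (fun v hv => by have h := hrec v hv; linarith [show (O (v + 2) : ℤ) + q + q = O (v + 1) + s + O v by exact_mod_cast h])
    (B := 2 * q) (fun v hv => by
      have h1 := hhi v; have h2 := hlo v (by omega)
      rw [abs_le]; constructor <;> linarith [show (O v : ℤ) < 2 * q by exact_mod_cast h1,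
        show (q : ℤ) < O v by exact_mod_cast h2])
  have hOv : ∀ v, t + 1 ≤ v → O v = 2 * q - s := by
    intro v hv
    have h := hy v hv
    have : (O v : ℤ) = 2 * q - s := by linarith
    omega
  refine ⟨t + 2, by omega, fun v hv => ⟨by rw [hO v, hOv v (by omega)], ?_⟩⟩
  obtain ⟨w, rfl⟩ : ∃ w, v = w + 1 := ⟨v - 1, by omega⟩
  rw [r_succ_eq W (w + 1) (hO (w + 1)), zigzag_kept_succ hroot W hz hk ht hb (by omega : t + 1 ≤ w) (hO w),
    hOv w (by omega), hOv (w + 1) (by omega), (hz w (by omega)).2, add_comm]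
  congr 1 <;> congr 1 <;> omega

/-- **LAW C, corollary (PROVED)**: a translation-recurrent pure zigzag tail on a high plateau has shade `s > q/2` —
child isolation (`pair_lt_of_isolatedTop`) on the rigid boundary `(q − s)(e_a + e_c)`. [new] [folklore] -/
theorem lt_two_mul_shade_of_zigzag (hroot : IsRoot q s₀) (W : ForcedWalk q s₀) {N s M : ℕ} (hsq : s < q)
    (hplat : ∀ t, N ≤ t → (W.st t).shade = (s : ℕ∞) ∧ ((q : ℕ) : ℕ∞) < ordZero (W.st t).F)
    (htr : ∀ M₀ : ℕ, ∃ i, M₀ ≤ i ∧ W.b i ≠ 0) (hNM : N ≤ M) (hz : IsZigzagFrom W M) : q < 2 * s := by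
  classical
  obtain ⟨M', hM', hrig⟩ := zigzag_rigid hroot W hsq hplat htr hNM hz
  obtain ⟨-, hr⟩ := hrig M' le_rfl
  have hne : W.j M' ≠ W.j (M' + 1) := fun h => (hz M' hM').1.1 h.symm
  have hlt := pair_lt_of_isolatedTop (W.isolated (M' + 1)) (W.j M') (W.j (M' + 1)) hne
    (X_pow_mul_X_pow_dvd_of_forall_le (walk_r hroot W (M' + 1)) hne)
  rw [hr, Finsupp.add_apply, Finsupp.add_apply, Finsupp.single_eq_same, Finsupp.single_eq_same,
    Finsupp.single_eq_of_ne hne, Finsupp.single_eq_of_ne hne.symm] at hlt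
  omega

end Zigzag

end Summit.ResolutionOfSingularities.ResolutionOfSingularities.Theorems.ConeCut
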